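import Literature.RingTheory.MvPolynomial.LexFirstVariable
import Mathlib.RingTheory.Ideal.Basic
import Mathlib.Algebra.MvPolynomial.CommRing
import HarnessLib

/-!
# Integrality of lexicographic reduction modulo the vanishing ideal of a `0/1` point set
# (Conneryd–Ghannane–Pang 2025, Lemma 5.3, in the "monic witnesses over `ℤ`" form)

Topic `Literature/RingTheory/MvPolynomial`.  Conneryd–Ghannane–Pang, *Lower Bounds for CSP
Hierarchies Through Ideal Reduction* (arXiv:2511.17272), Lemma 5.3 (Integrality lemma): *if `𝔽`
has characteristic zero and `V ⊆ {0,1}ⁿ ⊆ 𝔽ⁿ`, then for every monomial `m` the reduction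
`R^{lex}_{I(V)}(m)` has integer coefficients.*  Their proof goes through the lex game of
Felszeghy–Ráth–Rónyai.  We prove the statement in the following equivalent INTEGRAL form, from
which the reduction operator over `ℤ` is built in `BooleanLexNormalForm.lean`:

**`degree_mem_monicExponents`.** For a finite `V ⊆ {0,1}ⁿ` (points `Fin n → ℤ`), every non-zero
`f ∈ ℤ[X_0,…,X_{n-1}]` vanishing on `V` has the lexicographic leading exponent of a MONIC
integer polynomial vanishing on `V`.

(Equivalence with the printed form: a monomial reducible modulo `I(V)` over `ℚ` is the leading
monomial of some `f ∈ I(V) ∩ ℤ[X]` after clearing denominators, hence of a monic integer one, and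
reducing by monic integer polynomials keeps integer coefficients; conversely integrality of all
reductions yields monic integer witnesses `m - R(m)`.)

PROOF (ours; a direct induction on `n` replacing the lex game — a genuinely shorter road in
Lean).  Split on the `X_0`-degree `d` of the leading exponent `α` of `f` (the most significant
variable in Mathlib's `MonomialOrder.lex`):
* `d ≥ 2`: `X_0² - X_0` is monic, vanishes on `0/1` points, and its exponent lies below `α`;
* `d = 0`: then `f = f₀(X_1..)`, `f₀` vanishes on the tails of `V`; induct;
* `d = 1`: `f = X_0 f₁ + f₀` with `α = (1, deg f₁)`; on the tails `P⁰`, `P¹` of the points with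
  `X_0 = 0`, resp. `1`, we have `f₀ = 0` on `P⁰` and `f₁ + f₀ = 0` on `P¹`, so `f₁` vanishes on
  `P⁰ ∩ P¹`; by induction there is a monic `g₁` vanishing on `P⁰ ∩ P¹` with `deg g₁ = deg f₁`, and
  `F := X_0 g₁ - g₁ (1 - e_{P⁰})`, `e_{P⁰}` the (integer!) indicator polynomial of `P⁰`, is monic
  with `deg F = (1, deg g₁) = α` and vanishes on `V`.
The set of such exponents (`monicExponents V`) is an upper set (`monicExponents_of_le`).

Also here: the vanishing ideal `vanishing V` of a finite point set over any commutative ring, the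
predicate `IsZeroOne`, the indicator polynomials `indicatorPoly` with `eval_indicatorPoly`.

## References

* [ConnerydGhannanePang2025] J. Conneryd, Y. Ghannane, S. Pang, arXiv:2511.17272, Lemma 5.3
  (and Thm. 5.2 = [FRR06, Thm. 2], which we do not need). READ.
-/

noncomputable section

open MvPolynomial Finset
open scoped MonomialOrder

namespace Literature.RingTheory.MvPolynomial

/-! ### The vanishing ideal of a finite point set -/

section Vanishing

variable {σ : Type*} {R : Type*} [CommRing R]

/-- The VANISHING IDEAL `I(V) = {f | f(v) = 0 ∀ v ∈ V}` of a finite set of points `V ⊆ Rⁿ`, over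
any commutative ring `R`. [folklore] -/
def vanishing (V : Finset (σ → R)) : Ideal (MvPolynomial σ R) where
  carrier := {f | ∀ v ∈ V, eval v f = 0}
  add_mem' := fun {f g} hf hg v hv => by rw [map_add, hf v hv, hg v hv, add_zero]
  zero_mem' := fun v _ => map_zero _
  smul_mem' := fun c {f} hf v hv => by rw [smul_eq_mul, map_mul, hf v hv, mul_zero]

/-- Membership in the vanishing ideal. [folklore] -/
theorem mem_vanishing {V : Finset (σ → R)} {f : MvPolynomial σ R} :
    f ∈ vanishing V ↔ ∀ v ∈ V, eval v f = 0 := Iff.rfl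

/-- `V ↦ I(V)` is antitone. [folklore] -/
theorem vanishing_antitone {V W : Finset (σ → R)} (h : V ⊆ W) : vanishing W ≤ vanishing V :=
  fun _ hf v hv => hf v (h hv)

/-- A `0/1` POINT SET: all coordinates of all points are `0` or `1`. [folklore] -/
def IsZeroOne (V : Finset (σ → R)) : Prop :=
  ∀ v ∈ V, ∀ i, v i = 0 ∨ v i = 1

/-- Subsets of `0/1` point sets are `0/1`. [folklore] -/
theorem IsZeroOne.subset {V W : Finset (σ → R)} (h : IsZeroOne W) (hVW : V ⊆ W) : IsZeroOne V :=
  fun v hv => h v (hVW hv)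

/-- The Boolean axiom `X_i² - X_i` vanishes on a `0/1` point set. [folklore] -/
theorem X_mul_X_sub_X_mem_vanishing {V : Finset (σ → R)} (h : IsZeroOne V) (i : σ) :
    X i * X i - X i ∈ vanishing V := by
  intro v hv
  rcases h v hv i with h0 | h1
  · simp [h0]
  · simp [h1]

end Vanishing

/-! ### Indicator polynomials of `0/1` point sets -/

section Indicator

variable {n : ℕ}

/-- The INDICATOR POLYNOMIAL `e_P = ∑_{p ∈ P} ∏_i (X_i if p_i = 1 else 1 - X_i)` of a finite set
of `0/1` points, with integer coefficients. [folklore] -/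
def indicatorPoly (P : Finset (Fin n → ℤ)) : MvPolynomial (Fin n) ℤ :=
  ∑ p ∈ P, ∏ i, (if p i = 1 then X i else 1 - X i)

/-- On `0/1` points the product `∏_i (q_i if p_i = 1 else 1 - q_i)` is `[p = q]`. [folklore] -/
theorem prod_ite_eq_ite {p q : Fin n → ℤ} (hp : ∀ i, p i = 0 ∨ p i = 1)
    (hq : ∀ i, q i = 0 ∨ q i = 1) :
    (∏ i, (if p i = 1 then q i else 1 - q i)) = if p = q then 1 else 0 := by
  split_ifs with hpq
  · subst hpq
    refine Finset.prod_eq_one fun i _ => ?_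
    rcases hp i with h0 | h1
    · simp [h0]
    · simp [h1]
  · obtain ⟨i, hi⟩ : ∃ i, p i ≠ q i := by
      by_contra hall
      push Not at hall
      exact hpq (funext hall)
    refine Finset.prod_eq_zero (Finset.mem_univ i) ?_
    rcases hp i with h0 | h1 <;> rcases hq i with h0' | h1'
    · exact absurd (h0.trans h0'.symm) hi
    · simp [h0, h1']
    · simp [h1, h0']
    · exact absurd (h1.trans h1'.symm) hi

/-- `e_P(q) = [q ∈ P]` for `0/1` points. [folklore] -/
theorem eval_indicatorPoly {P : Finset (Fin n → ℤ)} (hP : IsZeroOne P) {q : Fin n → ℤ}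
    (hq : ∀ i, q i = 0 ∨ q i = 1) :
    eval q (indicatorPoly P) = if q ∈ P then 1 else 0 := by
  unfold indicatorPoly
  rw [map_sum]
  have : ∀ p ∈ P, eval q (∏ i, (if p i = 1 then X i else 1 - X i)) = if p = q then 1 else 0 := by
    intro p hp
    rw [map_prod]
    have hfac : ∀ i, eval q (if p i = 1 then X i else 1 - X i) = if p i = 1 then q i else 1 - q i :=
      fun i => by split_ifs <;> simp
    simp_rw [hfac]
    exact prod_ite_eq_ite (hP p hp) hq
  rw [Finset.sum_congr rfl this, Finset.sum_ite_eq']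

end Indicator

/-! ### Monic exponents and the integrality theorem -/

section Monic

variable {n : ℕ}

/-- The MONIC EXPONENTS of a point set `V ⊆ ℤⁿ`: the lexicographic leading exponents of the monic
integer polynomials vanishing on `V`. [cite: ConnerydGhannanePang2025, Lemma 5.3] -/
def monicExponents (V : Finset (Fin n → ℤ)) : Set (Fin n →₀ ℕ) :=
  {a | ∃ f ∈ vanishing V, MonomialOrder.lex.Monic f ∧ MonomialOrder.lex.degree f = a}

/-- The monic exponents form an upper set for the divisibility (pointwise) order. [folklore] -/
theorem monicExponents_of_le {V : Finset (Fin n → ℤ)} {a b : Fin n →₀ ℕ}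
    (ha : a ∈ monicExponents V) (hab : a ≤ b) : b ∈ monicExponents V := by
  obtain ⟨f, hfV, hmon, rfl⟩ := ha
  refine ⟨monomial (b - MonomialOrder.lex.degree f) (1 : ℤ) * f, (vanishing V).mul_mem_left _ hfV,
    MonomialOrder.Monic.mul MonomialOrder.monic_monomial_one hmon, ?_⟩
  rw [MonomialOrder.degree_mul_of_mul_leadingCoeff_ne_zero, MonomialOrder.degree_monomial,
    if_neg one_ne_zero, tsub_add_cancel_of_le hab]
  rw [MonomialOrder.leadingCoeff_monomial, hmon.leadingCoeff_eq_one, one_mul]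
  exact one_ne_zero

/-- Anti-monotonicity in the point set. [folklore] -/
theorem monicExponents_mono {V W : Finset (Fin n → ℤ)} (h : V ⊆ W) :
    monicExponents W ⊆ monicExponents V :=
  fun _ ⟨f, hf, hmon, hdeg⟩ => ⟨f, vanishing_antitone h hf, hmon, hdeg⟩

/-- `X_0² - X_0` witnesses every exponent of `X_0`-degree `≥ 2` (for `0/1` point sets).
[folklore] -/
theorem mem_monicExponents_of_two_le {V : Finset (Fin (n + 1) → ℤ)} (hV : IsZeroOne V)
    {a : Fin (n + 1) →₀ ℕ} (ha : 2 ≤ a 0) : a ∈ monicExponents V := by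
  have hlt : MonomialOrder.lex.degree (-(X 0 : MvPolynomial (Fin (n + 1)) ℤ)) ≺[MonomialOrder.lex]
      MonomialOrder.lex.degree (monomial (Finsupp.single (0 : Fin (n + 1)) 2) (1 : ℤ)) := by
    rw [MonomialOrder.degree_neg, MonomialOrder.degree_X, MonomialOrder.degree_monomial,
      if_neg one_ne_zero]
    exact lex_lt_of_apply_zero_lt (by simp)
  refine monicExponents_of_le (a := Finsupp.single 0 2)
    ⟨monomial (Finsupp.single 0 2) (1 : ℤ) + -X 0, ?_,
      MonomialOrder.Monic.add_of_lt MonomialOrder.monic_monomial_one hlt, ?_⟩ ?_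
  · have : monomial (Finsupp.single (0 : Fin (n + 1)) 2) (1 : ℤ) + -X 0 = X 0 * X 0 - X 0 := by
      rw [← sq, X_pow_eq_monomial, sub_eq_add_neg]
    rw [this]
    exact X_mul_X_sub_X_mem_vanishing hV 0
  · rw [MonomialOrder.degree_add_of_lt hlt, MonomialOrder.degree_monomial, if_neg one_ne_zero]
  · intro i
    by_cases hi : i = 0
    · subst hi; simpa using ha
    · rw [Finsupp.single_eq_of_ne hi]; exact Nat.zero_le _

/-- The tails of the points of `V` with prescribed first coordinate. [folklore] -/
def tails (V : Finset (Fin (n + 1) → ℤ)) (c : ℤ) : Finset (Fin n → ℤ) :=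
  (V.filter fun v => v 0 = c).image Fin.tail

/-- Membership in `tails`. [folklore] -/
theorem mem_tails {V : Finset (Fin (n + 1) → ℤ)} {c : ℤ} {p : Fin n → ℤ} :
    p ∈ tails V c ↔ ∃ v ∈ V, v 0 = c ∧ Fin.tail v = p := by
  simp [tails, and_assoc]

/-- The tail of a point lies in the corresponding `tails`. [folklore] -/
theorem tail_mem_tails {V : Finset (Fin (n + 1) → ℤ)} {v : Fin (n + 1) → ℤ} (hv : v ∈ V) :
    Fin.tail v ∈ tails V (v 0) :=
  mem_tails.2 ⟨v, hv, rfl, rfl⟩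

/-- Tails of `0/1` points are `0/1`. [folklore] -/
theorem IsZeroOne.tails {V : Finset (Fin (n + 1) → ℤ)} (hV : IsZeroOne V) (c : ℤ) :
    IsZeroOne (tails V c) := by
  intro p hp i
  obtain ⟨v, hv, -, rfl⟩ := mem_tails.1 hp
  exact hV v hv i.succ

/-- **Integrality of lexicographic reduction for `0/1` point sets** (Conneryd–Ghannane–Pang,
Lemma 5.3, monic-witness form): every non-zero integer polynomial vanishing on a finite
`V ⊆ {0,1}ⁿ` has the lexicographic leading exponent of a MONIC integer polynomial vanishing on
`V`.  Proof by induction on `n` splitting on the `X_0`-degree of the leading exponent (module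
docstring), instead of the lex game. [cite: ConnerydGhannanePang2025, Lemma 5.3] -/
theorem degree_mem_monicExponents : ∀ {n : ℕ} {V : Finset (Fin n → ℤ)}, IsZeroOne V →
    ∀ {f : MvPolynomial (Fin n) ℤ}, f ∈ vanishing V → f ≠ 0 →
      MonomialOrder.lex.degree f ∈ monicExponents V := by
  intro n
  induction n with
  | zero =>
    intro V _ f hf hf0
    -- `f` is a non-zero constant, so `V = ∅` and `1` is a monic witness
    have hV : V = ∅ := by
      by_contra hne
      obtain ⟨v, hv⟩ := Finset.nonempty_iff_ne_empty.2 hne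
      obtain ⟨c, rfl⟩ : ∃ c : ℤ, f = C c := ⟨coeff 0 f, eq_C_of_isEmpty f⟩
      have := hf v hv
      rw [eval_C] at this
      exact hf0 (by rw [this, C_0])
    subst hV
    exact ⟨1, fun v hv => absurd hv (Finset.notMem_empty v), MonomialOrder.monic_one,
      Subsingleton.elim _ _⟩
  | succ n ih =>
    intro V hV f hf hf0
    classical
    set α := MonomialOrder.lex.degree f with hα
    have hsupp : ∀ b ∈ f.support, b 0 ≤ α 0 :=
      fun b hb => lex_apply_zero_le_of_le (MonomialOrder.lex.le_degree hb)
    rcases Nat.lt_or_ge (α 0) 2 with hlt2 | hge2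
    swap
    · exact mem_monicExponents_of_two_le hV hge2
    -- `α 0 ≤ 1`: split `f = X 0 * f₁ + f₀`
    have hle1 : ∀ b ∈ f.support, b 0 ≤ 1 := fun b hb => (hsupp b hb).trans (by omega)
    set f₁ : MvPolynomial (Fin n) ℤ :=
      ∑ b ∈ f.support.filter (fun b => b 0 = 1), monomial (Finsupp.tail b) (coeff b f) with hf₁
    set f₀ : MvPolynomial (Fin n) ℤ :=
      ∑ b ∈ f.support.filter (fun b => b 0 = 0), monomial (Finsupp.tail b) (coeff b f) with hf₀
    have hdec : f = X 0 * rename Fin.succ f₁ + rename Fin.succ f₀ :=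
      eq_X_zero_mul_add_of_apply_zero_le_one hle1
    have heval : ∀ v : Fin (n + 1) → ℤ,
        eval v f = v 0 * eval (Fin.tail v) f₁ + eval (Fin.tail v) f₀ := by
      intro v
      conv_lhs => rw [hdec]
      rw [map_add, map_mul, eval_X, eval_rename_succ, eval_rename_succ]
    by_cases hf₁0 : f₁ = 0
    · -- `α 0 = 0`-type case: `f = f₀(X_1..)`
      have hf' : f = rename Fin.succ f₀ := by rw [hdec, hf₁0, map_zero, mul_zero, zero_add]
      have hf₀0 : f₀ ≠ 0 := by rintro h0; rw [h0, map_zero] at hf'; exact hf0 hf'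
      have hvan : f₀ ∈ vanishing (V.image Fin.tail) := by
        intro p hp
        obtain ⟨v, hv, rfl⟩ := Finset.mem_image.1 hp
        have := hf v hv
        rwa [hf', eval_rename_succ] at this
      have h01 : IsZeroOne (V.image Fin.tail) := by
        intro p hp i
        obtain ⟨v, hv, rfl⟩ := Finset.mem_image.1 hp
        exact hV v hv i.succ
      obtain ⟨g, hg, hgmon, hgdeg⟩ := ih h01 hvan hf₀0
      refine ⟨rename Fin.succ g, fun v hv => ?_, ?_, ?_⟩
      · rw [eval_rename_succ]; exact hg _ (Finset.mem_image_of_mem _ hv)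
      · rw [MonomialOrder.Monic, leadingCoeff_rename_succ]; exact hgmon
      · rw [degree_rename_succ, hgdeg, hα, hf', degree_rename_succ]
    · -- `α 0 = 1`: the main case
      have hP0 : ∀ p ∈ tails V 0, eval p f₀ = 0 := by
        intro p hp
        obtain ⟨v, hv, hv0, rfl⟩ := mem_tails.1 hp
        have := hf v hv
        rwa [heval, hv0, zero_mul, zero_add] at this
      have hP1 : ∀ p ∈ tails V 1, eval p f₁ + eval p f₀ = 0 := by
        intro p hp
        obtain ⟨v, hv, hv1, rfl⟩ := mem_tails.1 hp
        have := hf v hv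
        rwa [heval, hv1, one_mul] at this
      have hvan : f₁ ∈ vanishing (tails V 0 ∩ tails V 1) := by
        intro p hp
        rw [Finset.mem_inter] at hp
        have h1 := hP1 p hp.2
        rwa [hP0 p hp.1, add_zero] at h1
      obtain ⟨g₁, hg₁, hg₁mon, hg₁deg⟩ :=
        ih ((hV.tails 0).subset Finset.inter_subset_left) hvan hf₁0
      have hg₁0 : g₁ ≠ 0 := hg₁mon.ne_zero
      set e := indicatorPoly (tails V 0) with he
      refine ⟨X 0 * rename Fin.succ g₁ + rename Fin.succ (-(g₁ * (1 - e))), fun v hv => ?_, ?_, ?_⟩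
      · -- vanishing on `V`
        have hq : ∀ i, Fin.tail v i = 0 ∨ Fin.tail v i = 1 := fun i => hV v hv i.succ
        have hev : eval (Fin.tail v) e = if Fin.tail v ∈ tails V 0 then 1 else 0 :=
          eval_indicatorPoly (hV.tails 0) hq
        rw [map_add, map_mul, eval_X, eval_rename_succ, eval_rename_succ, map_neg, map_mul,
          map_sub, map_one, hev]
        rcases hV v hv 0 with h0 | h1
        · have hmem : Fin.tail v ∈ tails V 0 := h0 ▸ tail_mem_tails hv
          rw [if_pos hmem, h0]; ring
        · have hmem1 : Fin.tail v ∈ tails V 1 := h1 ▸ tail_mem_tails hv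
          by_cases hmem : Fin.tail v ∈ tails V 0
          · rw [if_pos hmem, h1, hg₁ _ (Finset.mem_inter.2 ⟨hmem, hmem1⟩)]; ring
          · rw [if_neg hmem, h1]; ring
      · -- monic
        rw [MonomialOrder.Monic, leadingCoeff_X_zero_mul_add hg₁0]
        exact hg₁mon
      · -- degree
        rw [degree_X_zero_mul_add hg₁0, hg₁deg, hα, hdec, degree_X_zero_mul_add hf₁0]

end Monic

end Literature.RingTheory.MvPolynomial
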